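import Summits.CriticalPhenomena.CardyFormulaZ2.Theses.CardyUniqueLimit

/-!
# `CardyUniqueLimit.LimitTransportGlue` (stmt-CriticalPhenomena-14241): the glue making X_U reachable

Route `CardyUniqueLimit`, sub-problem `CardyFormulaZ2`. The support item
`LimitTransportGlue : LimitExists → ConfInvTransport → CardyUniqueLimitThesis` (route-choice repair
2026-08-16) is pure logic plus choice: put `f η :=` the `LimitExists`-limit of SOME conformal
rectangle carrying a uniformizing datum of cross-ratio `η` (junk `0` if there is none); for `R`
with datum `(φ, x)` a witness of `η = crossRatio x` exists (e.g. `R` itself), its crossing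
probabilities tend to `f η` by the choice of limits, and `ConfInvTransport` carries that limit over
to `R`, which is `R.HasCrossingLimit (bondDomainCrossingProb R) f` at `(φ, x)`. Neither
`crossRatio_eq_of_isUniformizing` nor `exists_isUniformizing` is used. (The same argument is
`Theorems.SimilarityUpgradeReduction.thesis_of_confInvTransport_of_limitExists`, landed by the lead
of crux stmt-4597 in `CardyWhiteToColouredSimilarityUpgradeHeartsCoincide.lean`; it is repeated
here over the route file alone so that the closing theorem of stmt-14241 has no foreign imports.)

References: S. Smirnov, C. R. Acad. Sci. 333 (2001), Thm 1 (the shape of X_U on the triangular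
lattice); B. Bollobás, O. Riordan, *Percolation* (2006), Ch. 7.
-/

noncomputable section

namespace Summit.CriticalPhenomena.CardyFormulaZ2.Theorems

open Filter Topology Set
open Literature.Probability.RandomPlanarGeometry
open Literature.Probability.Percolation (bondDomainCrossingProb)
open Summit.CriticalPhenomena.CardyFormulaZ2.Theses.CardyUniqueLimit

/-- **`LimitTransportGlue` holds** (closes stmt-CriticalPhenomena-14241): existence of all bond-ℤ²
crossing limits plus conformal invariance in transport form give one function `f` of the
cross-ratio with `R.HasCrossingLimit (bondDomainCrossingProb R) f` for every conformal rectangle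
`R` (= X_U, `CardyUniqueLimitThesis`). Proof: choose the limits (`LimitExists`), define `f η` as
the limit of a chosen rectangle of modulus `η` (junk `0` if none), and transport. [folklore] -/
theorem limitTransportGlue_proof : LimitTransportGlue := by
  classical
  intro hL hT
  choose Lim hLim using hL
  refine ⟨fun η => if h : ∃ (S : ConformalRectangle)
      (ψ : ConformalEquiv UpperHalfPlane.upperHalfPlaneSet S.carrier) (y : Fin 4 → ℝ),
      S.IsUniformizing ψ y ∧ crossRatio y = η then Lim h.choose else 0, ?_⟩
  intro R φ x hx
  have h : ∃ (S : ConformalRectangle) (ψ : ConformalEquiv UpperHalfPlane.upperHalfPlaneSet S.carrier)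
      (y : Fin 4 → ℝ), S.IsUniformizing ψ y ∧ crossRatio y = crossRatio x := ⟨R, φ, x, hx, rfl⟩
  dsimp only
  rw [dif_pos h]
  obtain ⟨ψ, y, hy, hcr⟩ := h.choose_spec
  exact hT h.choose R ψ y φ x hy hx hcr (Lim h.choose) (hLim h.choose)

end Summit.CriticalPhenomena.CardyFormulaZ2.Theorems

end
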